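import Summits.BirchSwinnertonDyer.BirchSwinnertonDyer.Theorems.SmallImageMuTransferMuTransferX9StepFourModPTwist
import Summits.BirchSwinnertonDyer.Rank1Residual.X11b.MaxUnramifiedRestriction
import HarnessLib

/-!
# K6 crux `MuTransferX9` (stmt-BirchSwinnertonDyer-19276), STEP 4 ↔ Lemma 1 (iii): the COCYCLE-LEVEL
# seams at the auxiliary prime `q` — local representatives of `loc_q κ_q` and of `loc_q (T^ε Ψ)`, their
# values at local elements, and the vanishing of the second on the inertia group

Cell `b2b-bsdres`, unit `b2b-bsdres-x10` (N2 = X10b at `p = 3` class lead, GEN 38; G4 = STEP 4 hand;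
crux 19276, cell `bsd-smallim`, skeleton v6 sha16 a90a661b046bb403, stub `stub_stepsTwoFourOdd`; G3/G4
meeting point per `bsd-smallim-k6-c2` g3, STATUS 14:27Z). HONEST FRAMING: TOOL theorems; no definition, no
named fact, no `sorry`; nothing is asserted about any curve, nothing is booked; X9 stays TYPED at class level,
X10b (N2) keeps its label CONSTRUCTION-SHAPED / NEEDS X_A3. `--supports stmt-BirchSwinnertonDyer-19276`
(helper; closes nothing). PARTITION (D-0054): X9 (A4) · X10b (A5, `p = 3`) — prime-generic.

## Why

Lemma 1 (iii) (the `q`-term identification, `bsd-smallim-koly` g8 `…X9LocalQTerm`) is stated on LOCAL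
cocycles `φ : contOneCocycles (𝒯_J|_q)`, `ψ : contOneCocycles (𝒯'_J|_q)` with `[φ] ∈ H¹_tr`, `ψ|_{I_q} = 0`,
and values `φ τ_q`, `ψ Fr_q`; STEP 4 (x10 `…X9StepFour*`) is stated on the localisations of GLOBAL classes
`κ_q` and `T^ε Ψ`. This file provides the bridge, for any number field `K`, any discrete module / twist:

* §1 `localization_oneCocycleClass` — `loc_v [c] = [c ∘ res_v]` (the pull-back cocycle along
  `absGaloisRestrict K K_v`, tree `galoisCohomology.res_one_oneCocycleClass`), with its values
  `pullback_absGaloisRestrict_apply : (c ∘ res_v)(g) = c(res_v g)`;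
* §2 `iterate_shiftH1_oneCocycleClass` — `T^k [c] = [S^k ∘ c]` on `H¹(K, 𝒯_J)` and
  `iterate_pushCocycle_shift_apply : (S^k ∘ c)(g) = S^k (c g)`;
* §3 **`apply_absGaloisRestrict_eq_zero_of_localization_mem_unramified`** — if `loc_v [c]` is unramified
  at a finite `v ∤ p` where `ρ` is unramified (so inertia fixes the twist), then `c(res_v τ) = 0` for every
  `τ` in the inertia group of `K_v` (n1011/X11b `mem_unramifiedSubgroup_one_iff_forall_eq_zero`); hence the
  local representative of `loc_q (T^ε Ψ)` VANISHES ON INERTIA (`localCocycle_iterate_shift_apply_eq_zero_of_mem_absInertia`)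
  — Lemma 1 (iii)'s hypothesis `ψ|_{I_q} = 0` for the Selmer-side class of skeleton v6 (`Ψ` unramified at
  `q ∉ S₁`).

References: MU-TRANSFER-PROOF §2 Lemma 1, §5 STEP 4; J.-P. Serre, *Galois Cohomology* (1997), I §2.2–§2.4
[SerreGaloisCohomology1997]; J. S. Milne, *Arithmetic Duality Theorems* (2006), I §2 [MilneADT2006].
-/

-- the summit and its single problem are both named `BirchSwinnertonDyer` (registry layout D-0017)
set_option linter.dupNamespace false

set_option autoImplicit false

noncomputable section

open scoped ContRepresentation
open Function NumberField IsDedekindDomain Field CategoryTheory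
open scoped NumberField
open Literature.NumberTheory.GaloisRepresentations
open Literature.NumberTheory.GaloisRepresentations.DiscreteGaloisModule (mu MuCarrier pairing TateDual
  tateDual pairingDualIntertwining)
open Literature.NumberTheory.GaloisCohomology
open Literature.NumberTheory.EllipticCurves
open Summit.BirchSwinnertonDyer.Rank1Residual.GaloisImage
open _root_.TopRep _root_.ContRepresentation _root_.ContinuousCohomology

universe u

namespace Summit.BirchSwinnertonDyer.BirchSwinnertonDyer.Rank1Residual.StepFour

variable {K : Type u} [Field K] [NumberField K]

/-! ### §1 Localisation of a cocycle class = class of the pulled-back cocycle -/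

section Localization

variable {M : Type u} [AddCommGroup M] [TopologicalSpace M] [DiscreteTopology M]
  (ρ : DiscreteGaloisModule K M) (v : HeightOneSpectrum (𝓞 K))

/-- Values of the local representative `c ∘ res_v` (the tree's `contOneCocycles.pullback` along
`absGaloisRestrict K K_v`): `(c ∘ res_v)(g) = c (res_v g)`. [cite: SerreGaloisCohomology1997, I §2.4] -/
theorem pullback_absGaloisRestrict_apply (c : contOneCocycles ρ.toTopRep)
    (g : absoluteGaloisGroup (v.adicCompletion K)) :
    (contOneCocycles.pullback (absGaloisRestrict K (v.adicCompletion K)) (X := (ρ).toTopRep)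
        (Y := (GaloisRep.toLocal v (ρ)).toTopRep)
        (TopRep.ofHom ⟨ContinuousLinearMap.id ℤ (M), fun _ => rfl⟩) c).1 g =
      c.1 (absGaloisRestrict K (v.adicCompletion K) g) := rfl

/-- **`loc_v [c] = [c ∘ res_v]`** (tree `galoisCohomology.res_one_oneCocycleClass` at `E = K_v`).
[cite: SerreGaloisCohomology1997, I §2.4] -/
theorem localization_oneCocycleClass (c : contOneCocycles ρ.toTopRep) :
    galoisCohomology.localization ρ (Sum.inr v) 1 (oneCocycleClass ρ.toTopRep c) =
      oneCocycleClass (GaloisRep.toLocal v ρ).toTopRep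
        (contOneCocycles.pullback (absGaloisRestrict K (v.adicCompletion K)) (X := (ρ).toTopRep)
        (Y := (GaloisRep.toLocal v (ρ)).toTopRep)
        (TopRep.ofHom ⟨ContinuousLinearMap.id ℤ (M), fun _ => rfl⟩) c) :=
  galoisCohomology.res_one_oneCocycleClass (v.adicCompletion K) c

end Localization

/-! ### §2 Iterates of the shift on cocycle classes of a twist -/

section Shift

variable {p : ℕ} [Fact p.Prime] (κ : ZpExtension K p)
variable {M : Type u} [AddCommGroup M] [TopologicalSpace M] [DiscreteTopology M]
  (ρ : DiscreteGaloisModule K M) (hM : ∀ x : M, p • x = 0) (J : ℕ)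

omit [NumberField K] in
/-- Values of the `k`-fold pushed cocycle: `(S^k ∘ c)(g) = S^k (c g)`. [cite: SerreGaloisCohomology1997, I §2.2] -/
theorem iterate_pushCocycle_shift_apply (c : contOneCocycles (κ.twistModP ρ hM J).toTopRep) (k : ℕ)
    (g : absoluteGaloisGroup K) :
    ((κ.pushCocycle ρ hM J (κ.twistModPShift ρ hM J))^[k] c).1 g = (shiftEnd M J ^ k) (c.1 g) := by
  induction k generalizing c with
  | zero => simp
  | succ k ih =>
    rw [Function.iterate_succ_apply, ih, ZpExtension.pushCocycle_apply, ZpExtension.twistModPShift_apply,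
      ← Module.End.mul_apply, ← pow_succ]

omit [NumberField K] in
/-- **`T^k [c] = [S^k ∘ c]`** on `H¹(K, 𝒯_J)` (`shiftH1 = H¹(twistModPShift)`, k6-ty
`map_oneCocycleClass_twist`, iterated). [cite: SerreGaloisCohomology1997, I §2.2] -/
theorem iterate_shiftH1_oneCocycleClass (c : contOneCocycles (κ.twistModP ρ hM J).toTopRep) (k : ℕ) :
    (κ.shiftH1 ρ hM J)^[k] (oneCocycleClass (κ.twistModP ρ hM J).toTopRep c) =
      oneCocycleClass (κ.twistModP ρ hM J).toTopRep
        ((κ.pushCocycle ρ hM J (κ.twistModPShift ρ hM J))^[k] c) := by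
  induction k generalizing c with
  | zero => rfl
  | succ k ih =>
    rw [Function.iterate_succ_apply, Function.iterate_succ_apply, ← ih]
    congr 1
    exact κ.map_oneCocycleClass_twist ρ hM J (κ.twistModPShift ρ hM J) c

/-- **The local representative of `T^k [c]`** at a finite place `v`:
`loc_v (T^k [c]) = [(S^k ∘ c) ∘ res_v]`, with values `S^k (c (res_v g))`. [cite: SerreGaloisCohomology1997, I §2.4] -/
theorem localization_iterate_shiftH1_oneCocycleClass (v : HeightOneSpectrum (𝓞 K))
    (c : contOneCocycles (κ.twistModP ρ hM J).toTopRep) (k : ℕ) :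
    galoisCohomology.localization (κ.twistModP ρ hM J) (Sum.inr v) 1
        ((κ.shiftH1 ρ hM J)^[k] (oneCocycleClass (κ.twistModP ρ hM J).toTopRep c)) =
      oneCocycleClass (GaloisRep.toLocal v (κ.twistModP ρ hM J)).toTopRep
        (contOneCocycles.pullback (absGaloisRestrict K (v.adicCompletion K)) (X := (κ.twistModP ρ hM J).toTopRep)
        (Y := (GaloisRep.toLocal v (κ.twistModP ρ hM J)).toTopRep)
        (TopRep.ofHom ⟨ContinuousLinearMap.id ℤ (Fin J → M), fun _ => rfl⟩) ((κ.pushCocycle ρ hM J (κ.twistModPShift ρ hM J))^[k] c)) := by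
  rw [iterate_shiftH1_oneCocycleClass, localization_oneCocycleClass]

/-- Values of that local representative: `S^k (c (res_v g))`. [cite: SerreGaloisCohomology1997, I §2.4] -/
theorem localCocycle_iterate_shift_apply (v : HeightOneSpectrum (𝓞 K))
    (c : contOneCocycles (κ.twistModP ρ hM J).toTopRep) (k : ℕ)
    (g : absoluteGaloisGroup (v.adicCompletion K)) :
    (contOneCocycles.pullback (absGaloisRestrict K (v.adicCompletion K)) (X := (κ.twistModP ρ hM J).toTopRep)
        (Y := (GaloisRep.toLocal v (κ.twistModP ρ hM J)).toTopRep)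
        (TopRep.ofHom ⟨ContinuousLinearMap.id ℤ (Fin J → M), fun _ => rfl⟩) ((κ.pushCocycle ρ hM J (κ.twistModPShift ρ hM J))^[k] c)).1 g =
      (shiftEnd M J ^ k) (c.1 (absGaloisRestrict K (v.adicCompletion K) g)) := by
  rw [contOneCocycles.pullback_apply, iterate_pushCocycle_shift_apply]
  rfl

/-! ### §3 Unramified classes: the local representative vanishes on the inertia group -/

/-- **If `loc_v [c]` is unramified at a finite `v ∤ p` where `ρ` is unramified, then `c(res_v τ) = 0` for
every `τ` in the inertia group of `K_v`** (inertia fixes the twist `𝒯_J(ρ, κ)|_v` — Washington 13.2 via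
koly's lemma — so an unramified class has its cocycle vanishing ON THE NOSE on inertia: n1011/X11b
`mem_unramifiedSubgroup_one_iff_forall_eq_zero`). [cite: MilneADT2006, Ch. I §2 (unramified cohomology)] -/
theorem apply_absGaloisRestrict_eq_zero_of_localization_mem_unramified (v : HeightOneSpectrum (𝓞 K))
    (hur : GaloisRep.IsUnramifiedAt v ρ) (hvp : ((p : ℕ) : 𝓞 K) ∉ v.asIdeal)
    (c : contOneCocycles (κ.twistModP ρ hM J).toTopRep)
    (hc : galoisCohomology.localization (κ.twistModP ρ hM J) (Sum.inr v) 1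
        (oneCocycleClass (κ.twistModP ρ hM J).toTopRep c) ∈
      DiscreteGaloisModule.unramifiedSubgroup (GaloisRep.toLocal v (κ.twistModP ρ hM J)) 1)
    {τ : absoluteGaloisGroup (v.adicCompletion K)} (hτ : τ ∈ absInertia (v.adicCompletion K)) :
    c.1 (absGaloisRestrict K (v.adicCompletion K) τ) = 0 := by
  rw [localization_oneCocycleClass] at hc
  have h := (Summit.BirchSwinnertonDyer.Rank1Residual.X11b.LocBridge.mem_unramifiedSubgroup_one_iff_forall_eq_zero
    (GaloisRep.toLocal v (κ.twistModP ρ hM J))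
    (fun t ht w => toLocal_twistModP_apply_of_mem_absInertia κ ρ hM J v hur hvp ht w) _).1 hc τ hτ
  exact h

/-- **The local representative of `loc_v (T^k [c])` vanishes on inertia** when `[c]` is unramified at the
finite `v ∤ p` (`ρ` unramified at `v`): `S^k (c (res_v τ)) = 0` for `τ ∈ I_v` — Lemma 1 (iii)'s
hypothesis «`ψ|_{I_q} = 0`» for `ψ` := the local representative of `loc_q (T^ε Ψ)`, `Ψ = [Ψc]` the
Selmer-side class of skeleton v6 (unramified at `q ∉ S₁`). [cite: MilneADT2006, Ch. I §2 (unramified cohomology)] -/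
theorem localCocycle_iterate_shift_apply_eq_zero_of_mem_absInertia (v : HeightOneSpectrum (𝓞 K))
    (hur : GaloisRep.IsUnramifiedAt v ρ) (hvp : ((p : ℕ) : 𝓞 K) ∉ v.asIdeal)
    (c : contOneCocycles (κ.twistModP ρ hM J).toTopRep)
    (hc : galoisCohomology.localization (κ.twistModP ρ hM J) (Sum.inr v) 1
        (oneCocycleClass (κ.twistModP ρ hM J).toTopRep c) ∈
      DiscreteGaloisModule.unramifiedSubgroup (GaloisRep.toLocal v (κ.twistModP ρ hM J)) 1)
    (k : ℕ) {τ : absoluteGaloisGroup (v.adicCompletion K)} (hτ : τ ∈ absInertia (v.adicCompletion K)) :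
    (contOneCocycles.pullback (absGaloisRestrict K (v.adicCompletion K)) (X := (κ.twistModP ρ hM J).toTopRep)
        (Y := (GaloisRep.toLocal v (κ.twistModP ρ hM J)).toTopRep)
        (TopRep.ofHom ⟨ContinuousLinearMap.id ℤ (Fin J → M), fun _ => rfl⟩) ((κ.pushCocycle ρ hM J (κ.twistModPShift ρ hM J))^[k] c)).1 τ =
      0 := by
  rw [localCocycle_iterate_shift_apply,
    apply_absGaloisRestrict_eq_zero_of_localization_mem_unramified κ ρ hM J v hur hvp c hc hτ, map_zero]

/-- The unshifted case (`k = 0`): the local representative of an unramified class vanishes on inertia.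
[cite: MilneADT2006, Ch. I §2 (unramified cohomology)] -/
theorem localCocycle_apply_eq_zero_of_mem_absInertia (v : HeightOneSpectrum (𝓞 K))
    (hur : GaloisRep.IsUnramifiedAt v ρ) (hvp : ((p : ℕ) : 𝓞 K) ∉ v.asIdeal)
    (c : contOneCocycles (κ.twistModP ρ hM J).toTopRep)
    (hc : galoisCohomology.localization (κ.twistModP ρ hM J) (Sum.inr v) 1
        (oneCocycleClass (κ.twistModP ρ hM J).toTopRep c) ∈
      DiscreteGaloisModule.unramifiedSubgroup (GaloisRep.toLocal v (κ.twistModP ρ hM J)) 1)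
    {τ : absoluteGaloisGroup (v.adicCompletion K)} (hτ : τ ∈ absInertia (v.adicCompletion K)) :
    (contOneCocycles.pullback (absGaloisRestrict K (v.adicCompletion K)) (X := (κ.twistModP ρ hM J).toTopRep)
        (Y := (GaloisRep.toLocal v (κ.twistModP ρ hM J)).toTopRep)
        (TopRep.ofHom ⟨ContinuousLinearMap.id ℤ (Fin J → M), fun _ => rfl⟩) c).1 τ = 0 := by
  rw [contOneCocycles.pullback_apply]
  exact apply_absGaloisRestrict_eq_zero_of_localization_mem_unramified κ ρ hM J v hur hvp c hc hτ

end Shift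

end Summit.BirchSwinnertonDyer.BirchSwinnertonDyer.Rank1Residual.StepFour

end
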